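import Summits.QuantumFields.YangMills.Theorems.BalabanUVNodesN15FullPropagatorV1XSiteN15At
import Summits.QuantumFields.YangMills.Theorems.BalabanUVNodesN15FullPropagatorC2BgExactUnitN15At
import HarnessLib

/-!
# Route «BalabanUVNodes», cluster K4 «SpineRates» — node N15 = NE2: THE SITE LAYER WITH THE BACKGROUND LIVE IN THE TwoGrid ENTRY CURRENCY, XV — A `Live` SIZE-LIVE FAMILY WITH
# ALL THREE LAYERS READING THE BACKGROUND: part XII's operator-and-site-dressed sized family `v1XASiteObjects` with its U-blind unit kernel `v1CovS` REPLACED by dag-n15-a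
# V-D's EXACTLY DRESSED (2.156) unit-lattice kernel `tgCovBgEx` read at the abelianised component `φ ∘ A′` of the gauge field — `PairedFamilyGuard.Live ∧ N15At`

Cell `pub-ymgap`, WIDTH SEAT `pub-ymgap-dag-n15-w1` (generation 2; director-ym №197 ∕ HUMAN RULING D-0149; chair R455 (A) ∕ R461; plan g81∕g82 `W-SEAT-START-LIST.md` §n15).  `bears_on:
R4∕N15 · K3⁷ SpineGivenEndpointR13SepCoPH (stmt-QuantumFields-20544)`.  Filed `--supports stmt-QuantumFields-20544 --as helper` — COUNT-NEUTRAL.  Three plumbing `def`s (the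
abelianised coefficient pair `cfgOfGauge`, the unit kernel `v1CovBgEx`, the `NE2Objects₁₁` literal `v1XAllObjects`), the rest theorems; 0 `sorry`.  Imports part XII (`v1XASiteObjects`
road: `V1IndexSM`, `v1SitePertF∕C`, `ne2PlusSite_v1XAS_site`, `live_v1XAS_site`; through it dag-n15-c FILE 40 `fgInstanceV1GS`∕`fgFamilyV1XAS` and S-E `n15At_v1XAS`) and dag-n15-a V-D
(`…C2BgExactUnitN15At`: `tgCovBgEx`, `tgCovBgEx_ker`, `tgCovBgEx_one`, ★ `ne2PlusUnit_tgCovBgEx`) BY NAME; nothing in the tree is modified.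

WHY.  Part X gave the first family with all three layers reading `U` (dag-n15-c's C2 primitive-carrier family, `M` fixed — it cannot pass n15-w2's guard `Live`); part XII gave a
`Live` SIZE-LIVE family (FILE 40's `fgInstanceV1GS`, `gf.M = M` free) with operator AND site layers reading `U` but S-E's U-blind unit kernel.  The unit layer with the background
live EXISTS in the tree on the C2 carriers (V-D: Bałaban's own non-linear dressing `Δ_k(U) = (Sym Q_kE₀(U)Q_k*)⁻¹ − b` of the (2.156) covariance, window-free), at the SAME tori,
block maps and bond shifts as FILE 40's sized instance at the underlying index `sizedBase j`; the two carriers differ only in the configuration sort (`𝔄`-valued `A′` with the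
(3.35) window `C·M·α₀` versus abelianised first-order coefficient pairs `(c′, a′_μ)` with window `C·α₀`).  Reading V-D's kernel at the abelianised pair `(0, φ∘A′)` — the SAME
modelling step as part XII's site species — transports V-D's `NE2PlusUnit` to the sized carriers with the smallness `M·α₀ ≤ a₀` the guard wants, and closes the third layer.

WHAT.
* §1 def `cfgOfGauge φ A := (0, fun μ x => φ (A μ x))` (`cfgOfGauge_fst∕_snd∕_zero`); `abs_fgrad_φ_le`, `abs_fgrad_fgrad_φ_le`, `bshiftEquiv_comm'` (difference-quotient algebra);
  `reg335_fgInstanceV1GS_explicit` (FILE 40's sized (3.35) window unfolded); ★ `reg_cfgOfGauge` (THE WINDOW TRANSPORT: (3.35) of FILE 40's sized instance at `(c, α₀)` ⟹ (3.35) AND (3.36) of dag-n15-c's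
  primitive carrier at `(c, M·α₀)` for the abelianised pair — `|φ a| ≤ ‖a‖`, `n′·η′ = 1`, the bond shifts commute); `blockAvg_comp_φ`, ★ `avg₁_cfgOfGauge` (block-averaging commutes with
  the abelianisation: `avg₁ π (cfgOfGauge φ A) = cfgOfGauge φ (gavgM π A)` — the coarse member is read at the SIZED pairing's own `Ū`).
* §2 def `v1CovBgEx` (the U-seeing unit kernel on the sized carriers: V-D's `tgCovBgEx` at `cfgOfGauge φ A′`), `v1CovBgEx_ker` (HONEST UNFOLDING: fine member `C_ex^{(L^mL^k)}(0, φ∘A′)`,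
  coarse member `C_ex^{(L^k)}(0, φ∘Ā′)` at the pairing's block average `Ā′ = gavgM A′`), `v1CovBgEx_one` (at `A′ = 0` it IS part 76's genuine (2.156) difference `covDiff`),
  ★★★ `ne2PlusUnit_v1CovBgEx` (`NE2PlusUnit c₃₅` on the sub-index `m ≥ 1` of the sized family; constants V-D's, threshold `a₀` now a smallness of `M·α₀`).
* §3 ★★★ `n15At_v1XAll`, `live_and_n15At_v1XAll` (operator = FILE 40, site = part XII, unit = §2 — ALL THREE LAYERS READ THE BACKGROUND, and the family is `Live`); def `v1XAllObjects`,
  `live_and_n15At_v1XAllObjects`, `populated_v1XAllObjects`, `live_and_n15At_v1XAllObjects_family`, keyed face `s_N15_of_admits_v1XAll_family`.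

HONEST FRAMING.  Count-neutral composition BY NAME; every layer is MODEL-LEVEL with respect to the datum's background field exactly as its source says (operator: dag-n15-c's
`V′₁(A′)`-dressed GENUINE full `U ≡ 1` propagator, (3.35) window `C·M·α₀`; site: THE massless scalar site propagator dressed by the abelian component `φ∘A′`; unit: Bałaban's exact
(1.103) dressing of the (2.156) covariance at the abelianised pair `(0, φ∘A′)` — abelianised `Q`, `Sym` in the bond basis, as V-D says).  NOT Bałaban's multiscale `G(U)` ∕
`C^{(k)}(U)` at a general (3.35)-regular non-abelian `U` ([B9] Thms 3.1 ∕ 3.2 ∕ 3.15 NOT PRINTED as η-rates), NOT Node 00's [B9] operator layer of record — **N15 is NOT discharged**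
(typed 28∕28 · discharged 5∕28 of record unchanged); K3⁷ OPEN and not claimed (its v5 pins N15 to `fullGSizedObjects`; a re-pin is the plan's act); one finite four-torus programme
at fixed `ε` — NOT ℝ⁴, NOT infinite volume, NOT OS, NOT a mass gap, NOT Clay; R4 closes the conditional finite-𝕋⁴ rung `BalabanLadder.UV` only.  Restate-immune (no Theses import).
-/

set_option autoImplicit false

noncomputable section

open scoped BigOperators Matrix
open Finset

namespace Summit.QuantumFields.YangMills.BalabanUVNodes.N15.SiteLayerBg

open Literature.MathematicalPhysics.QuantumFieldTheory.Balaban1983to89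
open Literature.MathematicalPhysics.QuantumFieldTheory.Balaban1983to89.T4Continuum (T4Family ULoop)
open Literature.MathematicalPhysics.QuantumFieldTheory.Balaban1983to89.T4EtaRate (PairedInstance EtaPairing NE2PlusOperator NE2PlusSite NE2PlusUnit EtaRateIneqUnit)
open Literature.MathematicalPhysics.QuantumFieldTheory.Balaban1983to89.T4EtaRateUnitWitness (covDiff)
open Literature.MathematicalPhysics.QuantumFieldTheory.Balaban1983to89.T4EtaRateCoeffDefect (fibre blockAvg)
open Literature.MathematicalPhysics.QuantumFieldTheory.Balaban1983to89.B5Prop11Plancherel (Tor fine)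
open Literature.MathematicalPhysics.QuantumFieldTheory.Balaban1983to89.B6LowerBound2153Torus (rep rep_mem_pbox)
open Literature.MathematicalPhysics.QuantumFieldTheory.Balaban1983to89.NE2NodeTorus (ne2PlusOperator_reindex)
open Literature.MathematicalPhysics.QuantumFieldTheory.King1986.Torus (tdistT)
open Summit.QuantumFields.BalabanUV.T4Continuum.HistoryFlow (two_le_L)
open Summit.QuantumFields.YangMills.BalabanUVNodes.N15.TwoGrid (TGIndex tgGeoC)
open Summit.QuantumFields.YangMills.BalabanUVNodes.N15.VectorPiece (kingPrV bshiftEquiv bshiftEquiv_apply blkFine)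
open Summit.QuantumFields.YangMills.BalabanUVNodes.N15.MatrixSpecies (liftBlk blockAvgV)
open Summit.QuantumFields.YangMills.BalabanUVNodes.N15.BackgroundLayer (avg₁ blockAvg_zero fgrad fgrad_apply fgInstanceC2 gavgM sizedBase fgInstanceV1GS fgFamilyV1XAS fgInstanceV1GS_gf_M)
open Summit.QuantumFields.YangMills.BalabanUVNodes.N15.GenuineRecord (FGIndexL TGIndexS n15At_v1XAS)
open Summit.QuantumFields.YangMills.BalabanUVNodes.N15.UnitLayerBg (covBgEx tgCovBgEx tgCovBgEx_ker tgCovBgEx_one ne2PlusUnit_tgCovBgEx)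
open Summit.QuantumFields.YangMills.BalabanUVNodes.N15.PairedFamilyGuard (Live)
open Summit.QuantumFields.YangMills.BalabanUVNodes.N15.AtKeyedHome (s_N15_of_admits neZero_blockFactor)
open YMDAG.UVSplit (Datum RateCarriers RateRecordPred N15At S_N15 ne2OfRecord₁₁)

variable {d : ℕ} {L : ℕ} [NeZero L]
variable (d) (𝔄 : Type) [NormedRing 𝔄] [NormedAlgebra ℝ 𝔄] [CompleteSpace 𝔄] (ι : Type) [Fintype ι] [DecidableEq ι] [Nonempty ι] (e : 𝔄 ≃L[ℝ] (ι → ℝ)) (φ : 𝔄 →L[ℝ] ℝ)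

/-! ## §1 The abelianised coefficient pair `(0, φ∘A′)`; the window transport; block averages commute with the abelianisation -/

section Abelianise

variable {d} {𝔄}

/-- THE ABELIANISED FIRST-ORDER COEFFICIENT PAIR of an `𝔄`-valued gauge field read by the functional `φ`: `(c′, a′_μ) := (0, φ ∘ A′_μ)` (dag-n15-c's primitive-carrier configuration sort).
MODEL (said): one abelian component of the vector potential, no scalar coefficient. [cite: Balaban1985BackgroundPropagators, (3.35) p.396 (the letters the pair must carry)] -/
def cfgOfGauge {X : Type} (A : Fin (d + 1) → X → 𝔄) : (X → ℝ) × (Fin (d + 1) → X → ℝ) := (fun _ => 0, fun μ x => φ (A μ x))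

omit [CompleteSpace 𝔄] in
/-- Unfoldings. [folklore] -/
@[simp] theorem cfgOfGauge_fst {X : Type} (A : Fin (d + 1) → X → 𝔄) : (cfgOfGauge φ A).1 = fun _ => 0 := rfl

omit [CompleteSpace 𝔄] in
/-- Unfolding of the second component. [folklore] -/
@[simp] theorem cfgOfGauge_snd {X : Type} (A : Fin (d + 1) → X → 𝔄) (μ : Fin (d + 1)) (x : X) : (cfgOfGauge φ A).2 μ x = φ (A μ x) := rfl

omit [CompleteSpace 𝔄] in
/-- At the zero field the pair is the primitive carrier's `one = 0`. [folklore] -/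
theorem cfgOfGauge_zero {X : Type} : cfgOfGauge (d := d) φ (0 : Fin (d + 1) → X → 𝔄) = 0 := by
  refine Prod.ext rfl (funext fun μ => funext fun x => ?_)
  simp [cfgOfGauge]

omit [CompleteSpace 𝔄] in
/-- **BLOCK AVERAGING COMMUTES WITH THE ABELIANISATION** (one component): `blockAvg π (φ ∘ a′) = φ ∘ blockAvgV π a′` (`φ` linear). [folklore] -/
theorem blockAvg_comp_φ {X X' : Type} [Fintype X'] [DecidableEq X] (π : X' → X) (a' : X' → 𝔄) (x : X) :
    blockAvg π (fun x' => φ (a' x')) x = φ (blockAvgV π a' x) := by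
  simp only [blockAvg, blockAvgV, map_smul, map_sum, smul_eq_mul, div_eq_inv_mul]

omit [CompleteSpace 𝔄] in
/-- ★ **BLOCK AVERAGING COMMUTES WITH THE ABELIANISATION**: `avg₁ π (cfgOfGauge φ A′) = cfgOfGauge φ (gavgM π A′)` — the coarse member of the unit kernel below is read at the SIZED
pairing's own block-averaged field `Ā′ = gavgM π A′`. [folklore] -/
theorem avg₁_cfgOfGauge {X X' : Type} [Fintype X'] [DecidableEq X] (π : X' → X) (A : Fin (d + 1) → X' → 𝔄) :
    avg₁ (Fin (d + 1)) π (cfgOfGauge φ A) = cfgOfGauge φ (gavgM 𝔄 (Fin (d + 1)) π A) := by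
  refine Prod.ext ?_ (funext fun μ => funext fun x => ?_)
  · show blockAvg π (fun _ => (0 : ℝ)) = fun _ => 0
    exact blockAvg_zero π
  · show blockAvg π (fun x' => φ (A μ x')) x = φ (blockAvgV π (A μ) x)
    exact blockAvg_comp_φ φ π (A μ) x


omit [CompleteSpace 𝔄] in
/-- First difference quotient of an abelianised component: `|∇(φ∘a)(x)| ≤ n·B` from `‖a(e x) − a(x)‖ ≤ B` (`|φ| ≤ ‖·‖`, `n ≥ 0`). [folklore] -/
theorem abs_fgrad_φ_le (hφ : ∀ a : 𝔄, |φ a| ≤ ‖a‖) {X : Type} (n : ℝ) (hn : 0 ≤ n) (s : X ≃ X) (a : X → 𝔄) (x : X) {B : ℝ} (h : ‖a (s x) - a x‖ ≤ B) :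
    |fgrad n s (fun y => φ (a y)) x| ≤ n * B := by
  have hexp : fgrad n s (fun y => φ (a y)) x = n * φ (a (s x) - a x) := by simp only [fgrad_apply, map_sub]
  rw [hexp, abs_mul, abs_of_nonneg hn]
  exact mul_le_mul_of_nonneg_left ((hφ _).trans h) hn

omit [CompleteSpace 𝔄] in
/-- Mixed second difference quotient of an abelianised component: `|∇_κ∇_μ(φ∘a)(x)| ≤ n²·B` from the backward-forward letter `‖(a(e_κe_μx) − a(e_μx)) − (a(e_κx) − a(x))‖ ≤ B`
when the two shifts commute at `x`. [folklore] -/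
theorem abs_fgrad_fgrad_φ_le (hφ : ∀ a : 𝔄, |φ a| ≤ ‖a‖) {X : Type} (n : ℝ) (hn : 0 ≤ n) (sμ sκ : X ≃ X) (a : X → 𝔄) (x : X) (hcomm : sμ (sκ x) = sκ (sμ x)) {B : ℝ}
    (h : ‖(a (sκ (sμ x)) - a (sμ x)) - (a (sκ x) - a x)‖ ≤ B) :
    |fgrad n sκ (fgrad n sμ (fun y => φ (a y))) x| ≤ n * n * B := by
  have hexp : fgrad n sκ (fgrad n sμ (fun y => φ (a y))) x = n * n * φ ((a (sκ (sμ x)) - a (sμ x)) - (a (sκ x) - a x)) := by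
    simp only [fgrad_apply, map_sub, hcomm]
    ring
  rw [hexp, abs_mul, abs_of_nonneg (mul_nonneg hn hn)]
  exact mul_le_mul_of_nonneg_left ((hφ _).trans h) (mul_nonneg hn hn)

/-- The bond shifts of the fine 1-forms' index set commute. [folklore] -/
theorem bshiftEquiv_comm' {M : Fin (d + 1) → ℕ} (n : ℕ) (μ κ : Fin (d + 1)) (x : Tor (fine n M) × Fin (d + 1)) :
    bshiftEquiv M n μ (bshiftEquiv M n κ x) = bshiftEquiv M n κ (bshiftEquiv M n μ x) :=
  Prod.ext (by simp only [bshiftEquiv_apply]; abel) (by simp only [bshiftEquiv_apply])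

variable (d) (𝔄)

omit [CompleteSpace 𝔄] [DecidableEq ι] [Nonempty ι] in
/-- FILE 40's (3.35) window of the SIZED instance at `j`, unfolded: field `≤ cMα₀`, forward differences along the bond shifts `≤ cMα₀·η′`, backward-forward second differences
`≤ cMα₀·η′²`, fine spacing `η′ = L^{−k}·L^{−m}`. [cite: Balaban1985BackgroundPropagators, (3.35) p.396 (the window)] -/
theorem reg335_fgInstanceV1GS_explicit (hL : Odd L ∧ 1 < L) (j : TGIndexS × Fin (d + 1)) (c α₀ : ℝ) (A : (fgInstanceV1GS d 𝔄 ι hL j).Bf.Cfg)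
    (hA : (fgInstanceV1GS d 𝔄 ι hL j).Bf.Reg335 c α₀ A) :
    (∀ μ x, ‖A μ x‖ ≤ c * j.1.Msz * α₀) ∧
      (∀ μ κ x, ‖A μ (bshiftEquiv (TGIndex.Mn d hL j.1.toTGIndex) (L ^ j.1.m * L ^ j.1.k) κ x) - A μ x‖
          ≤ c * j.1.Msz * α₀ * (((L : ℝ) ^ j.1.k)⁻¹ * ((L : ℝ) ^ j.1.m)⁻¹)) ∧
      ∀ μ κ x, ‖(A μ (bshiftEquiv (TGIndex.Mn d hL j.1.toTGIndex) (L ^ j.1.m * L ^ j.1.k) κ x) - A μ x)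
          - (A μ (bshiftEquiv (TGIndex.Mn d hL j.1.toTGIndex) (L ^ j.1.m * L ^ j.1.k) κ ((bshiftEquiv (TGIndex.Mn d hL j.1.toTGIndex) (L ^ j.1.m * L ^ j.1.k) μ).symm x))
            - A μ ((bshiftEquiv (TGIndex.Mn d hL j.1.toTGIndex) (L ^ j.1.m * L ^ j.1.k) μ).symm x))‖
          ≤ c * j.1.Msz * α₀ * (((L : ℝ) ^ j.1.k)⁻¹ * ((L : ℝ) ^ j.1.m)⁻¹) * (((L : ℝ) ^ j.1.k)⁻¹ * ((L : ℝ) ^ j.1.m)⁻¹) :=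
  hA

omit [CompleteSpace 𝔄] [DecidableEq ι] [Nonempty ι] in
/-- ★ **THE WINDOW TRANSPORT TO THE PRIMITIVE CARRIER**: if `A′` is (3.35)-regular at `(c, α₀)` for FILE 40's SIZED instance at `j` (window `c·M·α₀`, quotients at the fine spacing
`η′ = L^{−k}·L^{−m}`), then the abelianised pair `(0, φ∘A′)` is (3.35)- AND (3.36)-regular at `(c, M·α₀)` for dag-n15-c's primitive carrier at the underlying index `sizedBase j` (window
`c·1·(Mα₀)`, difference quotients `n′·(f(x+e) − f(x))` with `n′ = L^mL^k`, so `n′η′ = 1`): `|φ a| ≤ ‖a‖`, `c ≥ 0`, `α₀ ≥ 0`; the mixed second quotient is FILE 40's backward-forward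
letter at the shifted point (the bond shifts commute). [cite: Balaban1985BackgroundPropagators, (3.35)–(3.36) p.396 (the letters)] -/
theorem reg_cfgOfGauge (hL : Odd L ∧ 1 < L) (hφ : ∀ a : 𝔄, |φ a| ≤ ‖a‖) (j : TGIndexS × Fin (d + 1)) {c α₀ : ℝ} (hc : 0 ≤ c) (hα₀ : 0 ≤ α₀)
    (A : (fgInstanceV1GS d 𝔄 ι hL j).Bf.Cfg) (hA : (fgInstanceV1GS d 𝔄 ι hL j).Bf.Reg335 c α₀ A) :
    (fgInstanceC2 d hL (sizedBase d j)).Bf.Reg335 c (j.1.Msz * α₀) (cfgOfGauge φ A) ∧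
      (fgInstanceC2 d hL (sizedBase d j)).Bf.Reg336 c (j.1.Msz * α₀) (cfgOfGauge φ A) := by
  obtain ⟨h1, h2, h3⟩ := reg335_fgInstanceV1GS_explicit d 𝔄 ι hL j c α₀ A hA
  have hL0 : (0 : ℝ) < (L : ℝ) := by have := hL.2; positivity
  have hLne : (L : ℝ) ≠ 0 := hL0.ne'
  have hn : (0 : ℝ) ≤ ((L ^ j.1.m * L ^ j.1.k : ℕ) : ℝ) := by positivity
  -- the fine quotient parameter times the fine spacing is one
  have hnη : ((L ^ j.1.m * L ^ j.1.k : ℕ) : ℝ) * (((L : ℝ) ^ j.1.k)⁻¹ * ((L : ℝ) ^ j.1.m)⁻¹) = 1 := by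
    push_cast
    rw [mul_comm (((L : ℝ) ^ j.1.k)⁻¹), mul_mul_mul_comm, mul_inv_cancel₀ (pow_ne_zero _ hLne), mul_inv_cancel₀ (pow_ne_zero _ hLne), one_mul]
  have hM0 : 0 ≤ c * (1 : ℝ) * (j.1.Msz * α₀) := by
    have : 0 ≤ c * j.1.Msz * α₀ := mul_nonneg (mul_nonneg hc (zero_le_one.trans j.1.one_le_Msz)) hα₀
    linarith
  -- the (3.36) letter: mixed second quotients
  have h336 : (fgInstanceC2 d hL (sizedBase d j)).Bf.Reg336 c (j.1.Msz * α₀) (cfgOfGauge φ A) := by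
    intro μ κ x'
    have h3' := h3 μ κ (bshiftEquiv (TGIndex.Mn d hL j.1.toTGIndex) (L ^ j.1.m * L ^ j.1.k) μ x')
    simp only [Equiv.symm_apply_apply] at h3'
    refine (abs_fgrad_fgrad_φ_le φ hφ _ hn _ _ (A μ) x' (bshiftEquiv_comm' (d := d) _ μ κ x') h3').trans (le_of_eq ?_)
    calc ((L ^ j.1.m * L ^ j.1.k : ℕ) : ℝ) * ((L ^ j.1.m * L ^ j.1.k : ℕ) : ℝ) *
          (c * j.1.Msz * α₀ * (((L : ℝ) ^ j.1.k)⁻¹ * ((L : ℝ) ^ j.1.m)⁻¹) * (((L : ℝ) ^ j.1.k)⁻¹ * ((L : ℝ) ^ j.1.m)⁻¹))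
        = c * j.1.Msz * α₀ * ((((L ^ j.1.m * L ^ j.1.k : ℕ) : ℝ) * (((L : ℝ) ^ j.1.k)⁻¹ * ((L : ℝ) ^ j.1.m)⁻¹)) *
            (((L ^ j.1.m * L ^ j.1.k : ℕ) : ℝ) * (((L : ℝ) ^ j.1.k)⁻¹ * ((L : ℝ) ^ j.1.m)⁻¹))) := by ring
      _ = c * (1 : ℝ) * (j.1.Msz * α₀) := by rw [hnη]; ring
  refine ⟨⟨⟨fun x' => ?_, fun μ x' => ?_⟩, ⟨fun κ x' => ?_, fun μ κ x' => ?_⟩, h336⟩, h336⟩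
  · show |(0 : ℝ)| ≤ c * (1 : ℝ) * (j.1.Msz * α₀)
    rw [abs_zero]; exact hM0
  · show |φ (A μ x')| ≤ c * (1 : ℝ) * (j.1.Msz * α₀)
    calc |φ (A μ x')| ≤ ‖A μ x'‖ := hφ _
      _ ≤ c * j.1.Msz * α₀ := h1 μ x'
      _ = c * (1 : ℝ) * (j.1.Msz * α₀) := by ring
  · show |fgrad _ _ (fun _ => (0 : ℝ)) x'| ≤ c * (1 : ℝ) * (j.1.Msz * α₀)
    simp only [fgrad_apply, sub_self, mul_zero, abs_zero]
    exact hM0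
  · refine (abs_fgrad_φ_le φ hφ _ hn _ (A μ) x' (h2 μ κ x')).trans (le_of_eq ?_)
    calc ((L ^ j.1.m * L ^ j.1.k : ℕ) : ℝ) * (c * j.1.Msz * α₀ * (((L : ℝ) ^ j.1.k)⁻¹ * ((L : ℝ) ^ j.1.m)⁻¹))
        = c * j.1.Msz * α₀ * (((L ^ j.1.m * L ^ j.1.k : ℕ) : ℝ) * (((L : ℝ) ^ j.1.k)⁻¹ * ((L : ℝ) ^ j.1.m)⁻¹)) := by ring
      _ = c * (1 : ℝ) * (j.1.Msz * α₀) := by rw [hnη]; ring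

end Abelianise

/-! ## §2 The U-seeing (2.156) unit kernel on the sized carriers; ★★★ `NE2PlusUnit` with the background live -/

section UnitKernel

/-- ★ **THE U-SEEING UNIT-LATTICE η-DIFFERENCE KERNEL ON THE SIZED CARRIERS, EXACT DRESSING**: dag-n15-a V-D's `tgCovBgEx` at the underlying index `sizedBase j`, READ AT THE
ABELIANISED PAIR `(0, φ∘A′)` of the sized instance's fine configuration `A′` — `(A′, y, y′) ↦ C_ex^{(L^mL^k)}(0, φ∘A′)((ȳ,α),(ȳ′,β)) − C_ex^{(L^k)}(0, φ∘Ā′)((ȳ,α),(ȳ′,β))`, `Ā′` the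
sized pairing's block average (`v1CovBgEx_ker`). [cite: Balaban1985BackgroundPropagators, Thm 3.15 (3.185)–(3.187) p.432 (shape of `C^{(k)}(Λ)(U)`); Balaban1984PropagatorsII, (2.156) p.250 (object at `U ≡ 1`)] -/
def v1CovBgEx (hL : Odd L ∧ 1 < L) (b : ℝ) (α β : Fin (d + 1)) (j : TGIndexS × Fin (d + 1)) :
    B9.SiteKernel (fgInstanceV1GS d 𝔄 ι hL j).gc (fgInstanceV1GS d 𝔄 ι hL j).Bf :=
  ⟨fun A y y' => (tgCovBgEx d hL b α β (sizedBase d j)).ker (cfgOfGauge φ A) y y'⟩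

omit [CompleteSpace 𝔄] [DecidableEq ι] [Nonempty ι] in
/-- **HONEST UNFOLDING**: the fine member is the exactly dressed (2.156) covariance at fineness `L^mL^k` read at `(0, φ∘A′)`, the coarse member the one at fineness `L^k` read at
`(0, φ∘Ā′)` with `Ā′ = (pair j).avg A′` the SIZED pairing's own block-averaged field (block averaging commutes with `φ`). [folklore] -/
theorem v1CovBgEx_ker (hL : Odd L ∧ 1 < L) (b : ℝ) (α β : Fin (d + 1)) (j : TGIndexS × Fin (d + 1)) (A : (fgInstanceV1GS d 𝔄 ι hL j).Bf.Cfg)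
    (y y' : Tor (TGIndex.Mn d hL j.1.toTGIndex)) :
    (v1CovBgEx d 𝔄 ι φ hL b α β j).ker A y y' =
      covBgEx (L := L) (TGIndex.Mn d hL j.1.toTGIndex) (L ^ j.1.m * L ^ j.1.k) b (fun _ => 0) (fun μ x => φ (A μ x))
          (⟨rep (TGIndex.Mn d hL j.1.toTGIndex) y, rep_mem_pbox (TGIndex.Mn d hL j.1.toTGIndex) y⟩, α)
          (⟨rep (TGIndex.Mn d hL j.1.toTGIndex) y', rep_mem_pbox (TGIndex.Mn d hL j.1.toTGIndex) y'⟩, β)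
        - covBgEx (L := L) (TGIndex.Mn d hL j.1.toTGIndex) (L ^ j.1.k) b (fun _ => 0) (fun μ x => φ ((fgInstanceV1GS d 𝔄 ι hL j).pair.avg A μ x))
          (⟨rep (TGIndex.Mn d hL j.1.toTGIndex) y, rep_mem_pbox (TGIndex.Mn d hL j.1.toTGIndex) y⟩, α)
          (⟨rep (TGIndex.Mn d hL j.1.toTGIndex) y', rep_mem_pbox (TGIndex.Mn d hL j.1.toTGIndex) y'⟩, β) := by
  show (tgCovBgEx d hL b α β (sizedBase d j)).ker (cfgOfGauge φ A) y y' = _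
  rw [tgCovBgEx_ker, avg₁_cfgOfGauge]
  rfl

omit [CompleteSpace 𝔄] [DecidableEq ι] [Nonempty ι] in
/-- ★ **AT `A′ = 0` THE KERNEL IS THE GENUINE (2.156) DIFFERENCE** `C^{(L^mL^k)} − C^{(L^k)}` at the bonds (V-D `tgCovBgEx_one` at the abelianised zero pair; `b > 0`).
[cite: Balaban1984PropagatorsII, (2.156) p.250 (object)] -/
theorem v1CovBgEx_one (hL : Odd L ∧ 1 < L) {b : ℝ} (hb : 0 < b) (α β : Fin (d + 1)) (j : TGIndexS × Fin (d + 1)) (y y' : Tor (TGIndex.Mn d hL j.1.toTGIndex)) :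
    (v1CovBgEx d 𝔄 ι φ hL b α β j).ker (fgInstanceV1GS d 𝔄 ι hL j).Bf.one y y' =
      covDiff L (TGIndex.Mn d hL j.1.toTGIndex) j.1.k j.1.m (⟨rep (TGIndex.Mn d hL j.1.toTGIndex) y, rep_mem_pbox (TGIndex.Mn d hL j.1.toTGIndex) y⟩, α)
        (⟨rep (TGIndex.Mn d hL j.1.toTGIndex) y', rep_mem_pbox (TGIndex.Mn d hL j.1.toTGIndex) y'⟩, β) := by
  show (tgCovBgEx d hL b α β (sizedBase d j)).ker
      (cfgOfGauge φ (0 : Fin (d + 1) → Tor (fine (L ^ (sizedBase d j).1.m * L ^ (sizedBase d j).1.k) (TGIndex.Mn d hL (sizedBase d j).1)) × Fin (d + 1) → 𝔄))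
      y y' = _
  rw [cfgOfGauge_zero]
  exact tgCovBgEx_one hL hb α β (sizedBase d j) y y'

omit [CompleteSpace 𝔄] [DecidableEq ι] [Nonempty ι] in
/-- ★★★ **`NE2PlusUnit` — THE NODE's THIRD CONJUNCT BY NAME — WITH THE BACKGROUND LIVE ON THE SIZED, `Live` CARRIERS**: for `d ≥ 1`, odd `L ≥ 3`, `b > 0`, `c₃₅ > 0`, `|φ| ≤ ‖·‖`
and every direction pair `α β`, `NE2PlusUnit c₃₅ (fgInstanceV1GS ∘ val) (v1CovBgEx ∘ val) ⊤ dist` on the sub-index `m ≥ 1` — V-D's `ne2PlusUnit_tgCovBgEx` (constants `(δ₀, a₀, B₀,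
θ = L^{−1∕16})` after `d, L, b, c₃₅`; window-free, NO Neumann series) transported along §1: the sized instance's smallness `M·α₀ ≤ a₀` IS the primitive carrier's `1·(Mα₀) ≤ a₀`,
its (3.35) window at `(c₃₅, α₀)` gives the primitive (3.35)∕(3.36) letters at `(c₃₅, Mα₀)` for `(0, φ∘A′)`, and the carriers share tori, `k`, and King's distance.
[cite: Balaban1985BackgroundPropagators, Thm 3.15 (3.185)–(3.187) p.432 (quantifier template, shape); Balaban1984PropagatorsII, (2.153)–(2.157) pp.249–250 (positivity, object);
Balaban1984PropagatorsI, (1.102)–(1.103) p.34 (the dressing map); King1986, Lemma 4.5 (4.38)–(4.41) pp.674–675 (shape, mechanism); CombesThomas1973, §II (mechanism)] -/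
theorem ne2PlusUnit_v1CovBgEx (hd : 1 ≤ d) (hLodd : Odd L) (hL2 : 2 ≤ L) (hL : Odd L ∧ 1 < L) {b : ℝ} (hb : 0 < b) {c35 : ℝ} (hc35 : 0 < c35)
    (hφ : ∀ a : 𝔄, |φ a| ≤ ‖a‖) (α β : Fin (d + 1)) :
    NE2PlusUnit c35 (fun j : V1IndexSM d => fgInstanceV1GS d 𝔄 ι hL j.1) (fun j => v1CovBgEx d 𝔄 ι φ hL b α β j.1) (fun _ _ => True)
      (fun j => (fgInstanceV1GS d 𝔄 ι hL j.1).gc.dist) := by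
  obtain ⟨δ₀, a₀, B₀, θ, hδ₀, ha₀, hB₀, hθ0, hθ1, H⟩ := ne2PlusUnit_tgCovBgEx (d := d) hd hLodd hL2 hL hb hc35 α β
  refine ⟨δ₀, a₀, B₀, θ, hδ₀, ha₀, hB₀, hθ0, hθ1, fun j α₀ hα₀ hMα A hreg _ y y' _ _ => ?_⟩
  have hMα' : j.1.1.Msz * α₀ ≤ a₀ := hMα
  have hpos : 0 < j.1.1.Msz * α₀ := mul_pos (zero_lt_one.trans_le j.1.1.one_le_Msz) hα₀
  obtain ⟨h335, h336⟩ := reg_cfgOfGauge d 𝔄 ι φ hL hφ j.1 hc35.le hα₀.le A hreg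
  exact H ⟨sizedBase d j.1, j.1.1.one_le_mT⟩ (j.1.1.Msz * α₀) hpos (show (1 : ℝ) * (j.1.1.Msz * α₀) ≤ a₀ by rwa [one_mul]) (cfgOfGauge φ A) h335 h336
    y y' trivial trivial

end UnitKernel

/-! ## §3 ★★★ `Live ∧ N15At` with ALL THREE layers reading the background; the `NE2Objects₁₁` literal; keyed face -/

section Knit

/-- ★★★ **`N15At` FOR THE SIZED GAUGE-DRESSED FAMILY WITH ALL THREE LAYERS READING THE BACKGROUND** (sub-index `m ≥ 1`): OPERATOR = FILE 40 `fgFamilyV1XAS` (S-E `n15At_v1XAS`'s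
first conjunct, reindexed), SITE = part XII `ne2PlusSite_v1XAS_site`, UNIT = §2 `ne2PlusUnit_v1CovBgEx`. `d ≥ 1`, odd `L ≥ 3`, `b, a_S, c₃₅ > 0`, `|φ| ≤ ‖·‖`. [bookkeeping] -/
theorem n15At_v1XAll (hd : 1 ≤ d) (hLodd : Odd L) (hL2 : 2 ≤ L) (hL : Odd L ∧ 1 < L) {b aS c35 : ℝ} (hb : 0 < b) (haS : 0 < aS) (hc35 : 0 < c35)
    (hφ : ∀ a : 𝔄, |φ a| ≤ ‖a‖) (α β : Fin (d + 1)) (p : ℝ) :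
    N15At { I := V1IndexSM d, c35 := c35, p := p, pi := fun j => fgInstanceV1GS d 𝔄 ι hL j.1, Kop := fun j => fgFamilyV1XAS d 𝔄 ι e hL b j.1,
            Ksite := sSiteExOn (fun j : V1IndexSM d => TGIndex.Mn d hL j.1.1.toTGIndex) (fun j => j.1.1.k) (fun j => j.1.1.m) (fun j => j.1.1.Msz)
              (fun j => (Tor (fine (L ^ j.1.1.k) (TGIndex.Mn d hL j.1.1.toTGIndex)) × Fin (d + 1)) × ι) (fun j => liftBlk (blkFine L j.1.1.k (TGIndex.Mn d hL j.1.1.toTGIndex)) ι)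
              (fun j => (fgInstanceV1GS d 𝔄 ι hL j.1).gf) (fun j => (fgInstanceV1GS d 𝔄 ι hL j.1).Bc) (fun j => (fgInstanceV1GS d 𝔄 ι hL j.1).Bf) aS
              (fun j => (fgInstanceV1GS d 𝔄 ι hL j.1).pair) (fun j A => v1SitePertF d 𝔄 ι φ hL aS j.1 A) (fun j B => v1SitePertC d 𝔄 ι φ hL aS j.1 B),
            Kunit := fun j => v1CovBgEx d 𝔄 ι φ hL b α β j.1, inΛ := fun _ _ => True, unitDist := fun j => (fgInstanceV1GS d 𝔄 ι hL j.1).gc.dist } := by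
  have h := n15At_v1XAS 𝔄 ι e hd hLodd hL2 hL hb haS hc35 α β p
  exact ⟨ne2PlusOperator_reindex (fun j : V1IndexSM d => j.1) h.1, ne2PlusSite_v1XAS_site d 𝔄 ι φ hLodd hL2 hL haS hc35.le hφ p,
    ne2PlusUnit_v1CovBgEx d 𝔄 ι φ hd hLodd hL2 hL hb hc35 hφ α β⟩

/-- ★★★ **GUARD ∧ `N15At` — A `Live` SIZE-LIVE FAMILY WITH ALL THREE LAYERS READING THE BACKGROUND** (operator: FILE 40's (3.52) species; site: part XII's species on THE massless scalar
site propagator; unit: §2's exactly dressed (2.156) kernel): `d ≥ 1`, odd `L ≥ 3`, `b, a_S, c₃₅ > 0`, `|φ| ≤ ‖·‖`. [bookkeeping] -/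
theorem live_and_n15At_v1XAll (hd : 1 ≤ d) (hLodd : Odd L) (hL2 : 2 ≤ L) (hL : Odd L ∧ 1 < L) {b aS c35 : ℝ} (hb : 0 < b) (haS : 0 < aS) (hc35 : 0 < c35)
    (hφ : ∀ a : 𝔄, |φ a| ≤ ‖a‖) (α β : Fin (d + 1)) (p : ℝ) :
    Live ⟨V1IndexSM d, c35, p, fun j => fgInstanceV1GS d 𝔄 ι hL j.1, fun j => fgFamilyV1XAS d 𝔄 ι e hL b j.1,
        sSiteExOn (fun j : V1IndexSM d => TGIndex.Mn d hL j.1.1.toTGIndex) (fun j => j.1.1.k) (fun j => j.1.1.m) (fun j => j.1.1.Msz)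
          (fun j => (Tor (fine (L ^ j.1.1.k) (TGIndex.Mn d hL j.1.1.toTGIndex)) × Fin (d + 1)) × ι) (fun j => liftBlk (blkFine L j.1.1.k (TGIndex.Mn d hL j.1.1.toTGIndex)) ι)
          (fun j => (fgInstanceV1GS d 𝔄 ι hL j.1).gf) (fun j => (fgInstanceV1GS d 𝔄 ι hL j.1).Bc) (fun j => (fgInstanceV1GS d 𝔄 ι hL j.1).Bf) aS
          (fun j => (fgInstanceV1GS d 𝔄 ι hL j.1).pair) (fun j A => v1SitePertF d 𝔄 ι φ hL aS j.1 A) (fun j B => v1SitePertC d 𝔄 ι φ hL aS j.1 B),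
        fun j => v1CovBgEx d 𝔄 ι φ hL b α β j.1, fun _ _ => True, fun j => (fgInstanceV1GS d 𝔄 ι hL j.1).gc.dist⟩ ∧
      N15At { I := V1IndexSM d, c35 := c35, p := p, pi := fun j => fgInstanceV1GS d 𝔄 ι hL j.1, Kop := fun j => fgFamilyV1XAS d 𝔄 ι e hL b j.1,
              Ksite := sSiteExOn (fun j : V1IndexSM d => TGIndex.Mn d hL j.1.1.toTGIndex) (fun j => j.1.1.k) (fun j => j.1.1.m) (fun j => j.1.1.Msz)
                (fun j => (Tor (fine (L ^ j.1.1.k) (TGIndex.Mn d hL j.1.1.toTGIndex)) × Fin (d + 1)) × ι) (fun j => liftBlk (blkFine L j.1.1.k (TGIndex.Mn d hL j.1.1.toTGIndex)) ι)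
                (fun j => (fgInstanceV1GS d 𝔄 ι hL j.1).gf) (fun j => (fgInstanceV1GS d 𝔄 ι hL j.1).Bc) (fun j => (fgInstanceV1GS d 𝔄 ι hL j.1).Bf) aS
                (fun j => (fgInstanceV1GS d 𝔄 ι hL j.1).pair) (fun j A => v1SitePertF d 𝔄 ι φ hL aS j.1 A) (fun j B => v1SitePertC d 𝔄 ι φ hL aS j.1 B),
              Kunit := fun j => v1CovBgEx d 𝔄 ι φ hL b α β j.1, inΛ := fun _ _ => True, unitDist := fun j => (fgInstanceV1GS d 𝔄 ι hL j.1).gc.dist } :=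
  ⟨live_v1XAS_site d 𝔄 ι hL hc35.le p _ _ _, n15At_v1XAll d 𝔄 ι e φ hd hLodd hL2 hL hb haS hc35 hφ α β p⟩

end Knit

section Record

/-- **N15's NE2 OBJECTS OF THE SIZED GAUGE-DRESSED FAMILY WITH ALL THREE LAYERS READING THE BACKGROUND** (RR-1's layer-A container): part XII's `v1XASiteObjects` with the unit kernel
§2's `v1CovBgEx`. [bookkeeping] -/
def v1XAllObjects (hL : Odd L ∧ 1 < L) (b aS : ℝ) (α β : Fin (d + 1)) (c35 p : ℝ) : Node00.NE2Objects₁₁ where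
  I := V1IndexSM d
  c35 := c35
  p := p
  pi := fun j => fgInstanceV1GS d 𝔄 ι hL j.1
  Kop := fun j => fgFamilyV1XAS d 𝔄 ι e hL b j.1
  Ksite := sSiteExOn (fun j : V1IndexSM d => TGIndex.Mn d hL j.1.1.toTGIndex) (fun j => j.1.1.k) (fun j => j.1.1.m) (fun j => j.1.1.Msz)
    (fun j => (Tor (fine (L ^ j.1.1.k) (TGIndex.Mn d hL j.1.1.toTGIndex)) × Fin (d + 1)) × ι) (fun j => liftBlk (blkFine L j.1.1.k (TGIndex.Mn d hL j.1.1.toTGIndex)) ι)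
    (fun j => (fgInstanceV1GS d 𝔄 ι hL j.1).gf) (fun j => (fgInstanceV1GS d 𝔄 ι hL j.1).Bc) (fun j => (fgInstanceV1GS d 𝔄 ι hL j.1).Bf) aS
    (fun j => (fgInstanceV1GS d 𝔄 ι hL j.1).pair) (fun j A => v1SitePertF d 𝔄 ι φ hL aS j.1 A) (fun j B => v1SitePertC d 𝔄 ι φ hL aS j.1 B)
  Kunit := fun j => v1CovBgEx d 𝔄 ι φ hL b α β j.1
  inΛ := fun _ _ => True
  unitDist := fun j => (fgInstanceV1GS d 𝔄 ι hL j.1).gc.dist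

variable {d}

/-- ★★★ **`Live ∧ N15At` AT THE OBJECTS' BUNDLE** (`d ≥ 1`, odd `L ≥ 3`, `b, a_S, c₃₅ > 0`, `|φ| ≤ ‖·‖`). [bookkeeping] -/
theorem live_and_n15At_v1XAllObjects (hd : 1 ≤ d) (hLodd : Odd L) (hL2 : 2 ≤ L) (hL : Odd L ∧ 1 < L) {b aS c35 : ℝ} (hb : 0 < b) (haS : 0 < aS) (hc35 : 0 < c35)
    (hφ : ∀ a : 𝔄, |φ a| ≤ ‖a‖) (α β : Fin (d + 1)) (p : ℝ) :
    Live (ne2OfRecord₁₁ (v1XAllObjects d 𝔄 ι e φ hL b aS α β c35 p)) ∧ N15At (ne2OfRecord₁₁ (v1XAllObjects d 𝔄 ι e φ hL b aS α β c35 p)) :=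
  live_and_n15At_v1XAll d 𝔄 ι e φ hd hLodd hL2 hL hb haS hc35 hφ α β p

omit [CompleteSpace 𝔄] [Nonempty ι] in
/-- RR-1's display: the objects are `Populated`. [bookkeeping] -/
theorem populated_v1XAllObjects (hL : Odd L ∧ 1 < L) (b aS : ℝ) (α β : Fin (d + 1)) (c35 p : ℝ) : (v1XAllObjects d 𝔄 ι e φ hL b aS α β c35 p).Populated :=
  (Node00.NE2Objects₁₁.populated_iff _).2 (v1IndexSM_nonempty d)

/-- `Live ∧ N15At` at the family-keyed literal (`d + 1 = 4`, the datum's own block factor `F.L`). [bookkeeping] -/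
theorem live_and_n15At_v1XAllObjects_family {b aS c35 : ℝ} (hb : 0 < b) (haS : 0 < aS) (hc35 : 0 < c35) (hφ : ∀ a : 𝔄, |φ a| ≤ ‖a‖) (α β : Fin 4) (p : ℝ) (F : T4Family) :
    Live (ne2OfRecord₁₁ (haveI := neZero_blockFactor F; v1XAllObjects 3 𝔄 ι e φ F.hL b aS α β c35 p)) ∧
      N15At (ne2OfRecord₁₁ (haveI := neZero_blockFactor F; v1XAllObjects 3 𝔄 ι e φ F.hL b aS α β c35 p)) := by
  haveI := neZero_blockFactor F
  exact live_and_n15At_v1XAllObjects (d := 3) 𝔄 ι e φ (by norm_num) F.hL.1 (two_le_L F) F.hL hb haS hc35 hφ α β p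

variable {N : ℕ} [NeZero N] {key : (F : T4Family) → Datum F N → Prop}

/-- ★★ **THE FAMILY-KEYED READING CLOSES THE STUB AT ANY KEYED HOME** (part 30's interface; `d + 1 = 4`, the datum's own block factor): a home admitting only the literals of a
key-indexed NE2 reading whose value everywhere IS `v1XAllObjects 3 …` has `S_N15 RRec` — the estimate is §3, not a hypothesis. [bookkeeping] -/
theorem s_N15_of_admits_v1XAll_family {b aS c35 : ℝ} (hb : 0 < b) (haS : 0 < aS) (hc35 : 0 < c35) (hφ : ∀ a : 𝔄, |φ a| ≤ ‖a‖) (α β : Fin 4) (p : ℝ)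
    (ne2At : ∀ {F : T4Family} {D : Datum F N}, key F D → (ℕ → ℝ) → List (ULoop F) → ℕ → Node00.NE2Objects₁₁) (RRec : RateRecordPred N)
    (hadm : ∀ (F : T4Family) (D : Datum F N) (g₀ : ℕ → ℝ) (os : List (ULoop F)) (R : RateCarriers N), RRec F D g₀ os R →
      ∃ (h : key F D) (k : ℕ), R.ne2 = ne2OfRecord₁₁ (ne2At h g₀ os k))
    (h : ∀ (F : T4Family) (D : Datum F N) (h : key F D) (g₀ : ℕ → ℝ) (os : List (ULoop F)) (k : ℕ),
      ne2At h g₀ os k = haveI := neZero_blockFactor F; v1XAllObjects 3 𝔄 ι e φ F.hL b aS α β c35 p) :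
    S_N15 RRec := by
  refine s_N15_of_admits ne2At RRec hadm fun F D hk g₀ os k => ?_
  rw [h F D hk g₀ os k]
  exact (live_and_n15At_v1XAllObjects_family 𝔄 ι e φ hb haS hc35 hφ α β p F).2

end Record

end Summit.QuantumFields.YangMills.BalabanUVNodes.N15.SiteLayerBg

end
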